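/-
Copyright (c) 2026 the pub-hodgecm-mathlib formalisation cell (harness21).  Prover seat hodgecm-mathlib-LH4-p10 (g5), 2026-09-04.  Track A «(D-RAM) FOUR-FRAME»,
STAGE-1b scoping brick (N-vol-wild) FILE 1 of 3 (dealer LH4-plan (g12) WORD #37; heir LEAD F0P3a-plan (g20) T19-24): the Heisenberg chart of `N ∩ K₃` at a
WILD (or tame) ramified non-split place — integral points, level and square-level profiles, and the fibres over the `x`-line.
-/
import Literature.NumberTheory.Automorphic.HeisenbergLevelTwoChartRamified     -- ★ `smul_map_heisElt_sub_one` (entries of `u(x,z)_w − 1`), ★ chart files A∕L1 (`isUnit_two_localRing`, `conjLocal_apply_eq_of_smul_eq`, …)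
import Literature.NumberTheory.Automorphic.HeisenbergChartShearedAtNonsplitPlace  -- ★ (LH7-p04): `heisElt_mem_cmLocalIntegralLevel_iff_heisZ` — `u(x,z) ∈ K₃ ⟺ |x_w| ≤ 1 ∧ |z_w| ≤ 1`, the 2-FREE `z`-reading (any residue characteristic)
import Literature.NumberTheory.LocalFields.WildQuadraticDatumTrace           -- ★ `WildQuadraticDatum.v_add_map_le_exp`, `exists_v_le_add_map_eq` (trace images `Tr 𝔭_E^j = 𝔭_F^{⌊(j+d)∕2⌋}`), `exists_v_eq_exp_of_map_eq_neg` (skew parity)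
import Literature.NumberTheory.Automorphic.UnitaryThreeFourFrameDefs         -- ★ #0a `IsRamifiedQuadraticDatum σ ϖ d t` (the place datum of the four-frame road)
import HarnessLib

/-!
# The Heisenberg chart of `N ∩ K₃` at a WILD ramified non-split place: integral points, level ∕ square-level profiles, and the `x`-fibres
# («the census shift `⌈d∕2⌉` is the trace defect of `N ∩ K₃`»)

Topic `NumberTheory/Automorphic`; namespace `Literature.NumberTheory.Automorphic.UnitaryGroup`.  KERNEL MATHEMATICS ONLY: theorems, no definition, no named fact,
no `sorry`, no instance, no notation.  Cell `pub/hodgecm-mathlib`, crux H413 = `stmt-HodgeConjecture-24833`, Track A «(D-RAM) FOUR-FRAME», STAGE-1b scoping (heir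
LEAD F0P3a-plan (g20) T19-24 «pre-scoping by idle hands»; dealer LH4-plan (g12) WORD #37 → seat LH4-p10 (g5), brick (N-vol-wild) «THE UNIPOTENT-FIBRE VOLUMES OF
THE UNLABELLED LEVEL PIECES AT A WILD PLACE», FILE 1 of 3).  HONEST LABEL: HC_CM is proved only modulo the 7 printed citations (2 remaining named inputs: hLiu418 =
`stmt-HodgeConjecture-24832`, h413 = `stmt-HodgeConjecture-24833`) until rung 0 closes; this file discharges nothing and pays no registered stub (count-neutral).

THE MATHEMATICS ([Rogawski1990] §1.10 p. 9, §4.9 p. 54; [Serre1979] III §3 Prop. 7, §6 Prop. 13; [Kottwitz1986BaseChangeUnits] §1).  `L` CM, `v` a finite place of `L⁺` NON-SPLIT in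
`L` (`w ∣ v`, `c • w = w`), `R = L ⊗ L⁺_v = ∏_{w′ ∣ v} L_{w′}` (one factor), `σ = c ⊗ 1`, `N = unipotentU σ Φ₃ ≤ U(Φ₃)(L⁺_v)` in the Heisenberg chart
`n = u(x, z) = heisElt x y`, `z = heisZ x y = y − ½ x σx`, `y ∈ R⁻` skew (★ `UnitaryGroupHeisenbergRing`; `2 ∈ R^×` at EVERY finite place, so the chart exists also at a
dyadic `v`), `K₃ = U(Φ₃)(𝒪_v)` (★ `cmLocalIntegralLevel`).  The tame files (★ `HeisenbergChartAtNonsplitPlace`, `…StrataMeasureRamified`) read `N ∩ K₃ = 𝒪 × 𝒪⁻` in the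
chart USING `|2|_w = 1`.  At a WILD place (`|2|_w < 1`) this fails: the honest chart reading is
  **`u(x, z) ∈ K₃ ⟺ |x_w| ≤ 1 ∧ |z_w| ≤ 1`** (★ `heisElt_mem_cmLocalIntegralLevel_iff_heisZ`, LH7-p04's 2-FREE `z`-reading: entries of `u` and `u⁻¹` are `1, 0, ±x, ±σx, z, σz`),
and for FIXED `x` the fibre `{y ∈ R⁻ : |z_w| ≤ |ϖ|^a}` is governed by the TRACE: `z + σz = −xσx` (★ `heisZ_add_map`), so a `y` exists iff `−x_wσx_w ∈ Tr_{L_w∕L⁺_v}(𝔓_w^a)`,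
i.e. — by the trace images `Tr 𝔓_E^j = 𝔭_F^{⌊(j+d)∕2⌋}` of the ramified quadratic datum `(σ_w, ϖ, d, t)` (★ `WildQuadraticDatumTrace`, `d = v_E(ϖ − σϖ)` the different
exponent) — **iff `|x_w| ≤ |ϖ|^{⌊(a+d)∕2⌋}`**, and then the fibre is a COSET `y₀ + B_a` of the skew ball `B_a = {y ∈ R⁻ : |y_w| ≤ |ϖ|^a}`.  At `a = 0` this is the statement
«the `x`-projection of `N ∩ K₃` is the ball of radius `|ϖ|^{⌊d∕2⌋}`», i.e. F0P3a-p01 (g35)'s empirical census shift `c = ⌈d∕2⌉ = d − ⌊d∕2⌋` (SIGSHEET-1b-levels F2, Levi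
row R3) IS the trace defect of `N ∩ K₃` (LH4-p08 (g7) PRESCOPE-T± v3 §8 (a)).  The LEVEL profiles of the STAGE-1b unlabelled pieces read, on `n = u(x, z)` with
`X := n_w − 1 = [[0, x_w, z_w], [0, 0, −σx_w], [0, 0, 0]]`, `X² = [[0, 0, −x_wσx_w], 0, 0]`:  `X ∈ ϖ^a M₃(𝒪_w) ⟺ |x_w| ≤ |ϖ|^a ∧ |z_w| ≤ |ϖ|^a`,
`X² ∈ ϖ^m M₃(𝒪_w) ⟺ |x_w|² ≤ |ϖ|^m ⟺ |x_w| ≤ |ϖ|^{⌈m∕2⌉}` — all in the `InLevel` idiom `∀ i j, |(ϖ^a)⁻¹ · X i j| ≤ 1` of ★ DEFS №3 `F0P3cDyRamFourFramePieces`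
(stated here unfolded, so that the Summits consumer closes the gap by `Iff.rfl`).  FILES 2–3 (`HeisenbergWildFibreHaar`, `HeisenbergWildLevelFibreVolume`)
integrate these fibres against every Haar measure of `N`.

* §1 `ℤᵐ⁰` bookkeeping: `γ·γ ≤ exp(−m) ⟺ γ ≤ exp(−⌈m∕2⌉)`, `|(ϖ^a)⁻¹ e| ≤ 1 ⟺ |e| ≤ exp(−a)`.
* §2 the chart at `w`: entries of `u(x,z)_w − 1` and of its square; the level-`a` and square-level-`m` profiles in chart coordinates (`K₃`-membership itself is the
  2-free ★ `heisElt_mem_cmLocalIntegralLevel_iff_heisZ`).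
* §3 the trace of `z`: `z_w + σ_w z_w = −x_w σ_w x_w`; the `x`-FIBRE: non-empty ⟹ `|x_w| ≤ exp(−⌊(a+d)∕2⌋)` (`v_apply_le_of_valued_heisZ_le`), and conversely a skew `y₀` with
  `|z_w| ≤ exp(−a)` exists (`exists_skew_valued_heisZ_le`); the fibre is the coset `y₀ + B_a` (`setOf_valued_heisZ_le_eq_vadd`).
* §4 skew parity on `R⁻`: `|y_w| = exp(2n − d)` (`exists_valued_skew_apply_eq_exp`), hence `B_k = B_{k+1}` whenever `k + d` is odd (`setOf_skew_valued_le_exp_eq_succ_of_odd`).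

## References
* [Rogawski1990] J. D. Rogawski, *Automorphic Representations of Unitary Groups in Three Variables*, Ann. of Math. Stud. 123 (1990), §1.10 p. 9 (the Heisenberg group
  `N`, `x x̄ + z + z̄ = 0`); §4.9 Prop. 4.9.1 (b) p. 55 (constant terms along `N`).
* [Serre1979] J.-P. Serre, *Local Fields*, GTM 67 (1979), Ch. III §3 Prop. 7 (`Tr 𝔟 ⊆ 𝔞 ⟺ 𝔟 ⊆ 𝔞𝒟⁻¹`), §6 Prop. 13 (the different of a totally ramified extension).
* [Kottwitz1986BaseChangeUnits] R. E. Kottwitz, *Base change for unit elements of Hecke algebras*, Compositio Math. 60 (1986), §1 pp. 240–241 (congruence-level pieces).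
-/

set_option autoImplicit false

noncomputable section

open IsDedekindDomain NumberField Matrix
open scoped NumberField MatrixGroups Matrix WithZero Pointwise

namespace Literature.NumberTheory.Automorphic.UnitaryGroup

open Literature.NumberTheory.Automorphic Literature.NumberTheory.Automorphic.IntegralReduction Literature.NumberTheory.GaloisRepresentations
open Literature.NumberTheory.LocalFields

variable (L : Type) [Field L] [NumberField L] [IsCMField L] (v : HeightOneSpectrum (𝓞 ↥(maximalRealSubfield L)))
  (w : PlacesOver L v) (hw : IsCMField.complexConj L • w.1 = w.1)

/-! ## §1 `ℤᵐ⁰` bookkeeping -/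

/-- In `ℤᵐ⁰`: `γ·γ ≤ exp(−m) ⟺ γ ≤ exp(−⌈m∕2⌉)` (`⌈m∕2⌉ = (m+1)∕2` in `ℕ`; `γ = 0` or `γ = exp k`). [cite: Serre1979, Ch. III §3 Prop. 7] -/
theorem WithZero.mul_self_le_exp_neg_iff (γ : ℤᵐ⁰) (m : ℕ) :
    γ * γ ≤ WithZero.exp (-(m : ℤ)) ↔ γ ≤ WithZero.exp (-(((m + 1) / 2 : ℕ) : ℤ)) := by
  by_cases hγ : γ = 0
  · rw [hγ, zero_mul]
    exact ⟨fun _ => zero_le, fun _ => zero_le⟩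
  · rw [← WithZero.exp_log hγ, ← WithZero.exp_add, WithZero.exp_le_exp, WithZero.exp_le_exp]
    omega

/-- In a `ℤᵐ⁰`-valued field with `|ϖ| = exp(−1)`: `|(ϖ^a)⁻¹·e| ≤ 1 ⟺ |e| ≤ exp(−a)`. [cite: Kottwitz1986BaseChangeUnits, §1 pp. 240–241] -/
theorem valued_inv_pow_mul_le_one_iff {K : Type*} [Field K] [Valued K ℤᵐ⁰] {ϖ : K} (hϖ : Valued.v ϖ = WithZero.exp (-1 : ℤ)) (a : ℕ) (e : K) :
    Valued.v ((ϖ ^ a)⁻¹ * e) ≤ 1 ↔ Valued.v e ≤ WithZero.exp (-(a : ℤ)) := by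
  have hpow : Valued.v (ϖ ^ a) = WithZero.exp (-(a : ℤ)) := by rw [map_pow]; exact WildQuadraticDatum.v_varpi_pow hϖ a
  have hne : Valued.v (ϖ ^ a) ≠ 0 := by rw [hpow]; exact WithZero.coe_ne_zero
  rw [map_mul, map_inv₀, hpow]
  rw [hpow] at hne
  constructor
  · intro h
    calc Valued.v e = WithZero.exp (-(a : ℤ)) * ((WithZero.exp (-(a : ℤ)))⁻¹ * Valued.v e) := by rw [← mul_assoc, mul_inv_cancel₀ hne, one_mul]
      _ ≤ WithZero.exp (-(a : ℤ)) * 1 := mul_le_mul' le_rfl h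
      _ = WithZero.exp (-(a : ℤ)) := mul_one _
  · intro h
    calc (WithZero.exp (-(a : ℤ)))⁻¹ * Valued.v e ≤ (WithZero.exp (-(a : ℤ)))⁻¹ * WithZero.exp (-(a : ℤ)) := mul_le_mul' le_rfl h
      _ = 1 := inv_mul_cancel₀ hne

/-! ## §2 The chart at `w`: entries of `u_w − 1` and `(u_w − 1)²`; the level and square-level profiles in coordinates -/

/-- **The entries of `u(x, z)_w − 1`**: `[[0, x_w, z_w], [0, 0, −(σx)_w], [0, 0, 0]]` (★ `smul_map_heisElt_sub_one` at `c = 1`). [cite: Rogawski1990, §1.10 p. 9] -/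
theorem map_heisElt_sub_one_eq [Invertible (2 : LocalRing L v)] (x : LocalRing L v) (y : HeisRing.skewPart (conjLocal L (IsCMField.complexConj L) v)) :
    (((HeisRing.heisElt (conjLocal L (IsCMField.complexConj L) v) (conjLocal_conjLocal_cm L v) (cmLocalForm_eq_over L 3 v) x y :
          ↥(unitaryGroupOfForm (conjLocal L (IsCMField.complexConj L) v) (cmLocalForm L 3 v))) : GL (Fin 3) (LocalRing L v)).val.map
          (Pi.evalRingHom (fun w' : PlacesOver L v => w'.1.adicCompletion L) w)) - 1 =
      !![0, x w, (HeisRing.heisZ (conjLocal L (IsCMField.complexConj L) v) x (y : LocalRing L v)) w;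
        0, 0, -((conjLocal L (IsCMField.complexConj L) v x) w);
        0, 0, (0 : w.1.adicCompletion L)] := by
  have h := smul_map_heisElt_sub_one L v w (1 : w.1.adicCompletion L) x y
  rw [one_smul] at h
  rw [h]
  ext i j
  fin_cases i <;> fin_cases j <;> simp

/-- **The square `(u(x, z)_w − 1)²` has the single corner entry `−x_w·(σx)_w`.** [cite: Rogawski1990, §1.10 p. 9] -/
theorem map_heisElt_sub_one_mul_self_eq [Invertible (2 : LocalRing L v)] (x : LocalRing L v) (y : HeisRing.skewPart (conjLocal L (IsCMField.complexConj L) v)) :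
    ((((HeisRing.heisElt (conjLocal L (IsCMField.complexConj L) v) (conjLocal_conjLocal_cm L v) (cmLocalForm_eq_over L 3 v) x y :
          ↥(unitaryGroupOfForm (conjLocal L (IsCMField.complexConj L) v) (cmLocalForm L 3 v))) : GL (Fin 3) (LocalRing L v)).val.map
          (Pi.evalRingHom (fun w' : PlacesOver L v => w'.1.adicCompletion L) w)) - 1) *
      ((((HeisRing.heisElt (conjLocal L (IsCMField.complexConj L) v) (conjLocal_conjLocal_cm L v) (cmLocalForm_eq_over L 3 v) x y :
          ↥(unitaryGroupOfForm (conjLocal L (IsCMField.complexConj L) v) (cmLocalForm L 3 v))) : GL (Fin 3) (LocalRing L v)).val.map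
          (Pi.evalRingHom (fun w' : PlacesOver L v => w'.1.adicCompletion L) w)) - 1) =
      !![0, 0, -(x w * (conjLocal L (IsCMField.complexConj L) v x) w);
        0, 0, 0;
        0, 0, (0 : w.1.adicCompletion L)] := by
  rw [map_heisElt_sub_one_eq L v w x y]
  ext i j
  fin_cases i <;> fin_cases j <;> simp [Matrix.mul_apply, Fin.sum_univ_three]

include hw in
/-- **THE LEVEL-`a` PROFILE IN THE CHART**: `u(x,z)_w − 1 ∈ ϖ^a M₃(𝒪_w)` (the `InLevel ϖ a` idiom `∀ i j, |(ϖ^a)⁻¹·X i j| ≤ 1` of ★ DEFS №3) `⟺ |x_w| ≤ |ϖ|^a ∧ |z_w| ≤ |ϖ|^a`.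
[cite: Kottwitz1986BaseChangeUnits, §1 pp. 240–241] [cite: Rogawski1990, §1.10 p. 9] -/
theorem forall_valued_map_heisElt_sub_one_le_iff [Invertible (2 : LocalRing L v)] {ϖ : w.1.adicCompletion L} (hϖ : Valued.v ϖ = WithZero.exp (-1 : ℤ)) (a : ℕ)
    (x : LocalRing L v) (y : HeisRing.skewPart (conjLocal L (IsCMField.complexConj L) v)) :
    (∀ i j : Fin 3, Valued.v ((ϖ ^ a)⁻¹ *
        ((((HeisRing.heisElt (conjLocal L (IsCMField.complexConj L) v) (conjLocal_conjLocal_cm L v) (cmLocalForm_eq_over L 3 v) x y :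
          ↥(unitaryGroupOfForm (conjLocal L (IsCMField.complexConj L) v) (cmLocalForm L 3 v))) : GL (Fin 3) (LocalRing L v)).val.map
          (Pi.evalRingHom (fun w' : PlacesOver L v => w'.1.adicCompletion L) w)) - 1) i j) ≤ 1) ↔
      Valued.v (x w) ≤ WithZero.exp (-(a : ℤ)) ∧
        Valued.v ((HeisRing.heisZ (conjLocal L (IsCMField.complexConj L) v) x (y : LocalRing L v)) w) ≤ WithZero.exp (-(a : ℤ)) := by
  have hσv : ∀ r : LocalRing L v, Valued.v (conjLocal L (IsCMField.complexConj L) v r w) = Valued.v (r w) := valued_conjLocal_apply_of_smul_eq L v w hw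
  rw [map_heisElt_sub_one_eq L v w x y]
  simp only [valued_inv_pow_mul_le_one_iff hϖ]
  constructor
  · intro h
    have h01 := h 0 1
    have h02 := h 0 2
    simp only [Matrix.of_apply, Matrix.cons_val', Matrix.cons_val_zero, Matrix.cons_val_one, Matrix.cons_val_two,
      Matrix.empty_val', Matrix.cons_val_fin_one, Matrix.head_cons, Matrix.tail_cons] at h01 h02
    exact ⟨h01, h02⟩
  · rintro ⟨hx, hz⟩
    have hσx : Valued.v (-((conjLocal L (IsCMField.complexConj L) v x) w)) ≤ WithZero.exp (-(a : ℤ)) := by rw [Valuation.map_neg, hσv]; exact hx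
    have h0 : Valued.v (0 : w.1.adicCompletion L) ≤ WithZero.exp (-(a : ℤ)) := by rw [map_zero]; exact zero_le
    intro i j
    fin_cases i <;> fin_cases j <;>
      simp only [Matrix.of_apply, Matrix.cons_val', Matrix.cons_val_zero, Matrix.cons_val_one, Matrix.cons_val_two,
        Matrix.empty_val', Matrix.cons_val_fin_one, Matrix.head_cons, Matrix.tail_cons, Fin.zero_eta, Fin.mk_one, Fin.reduceFinMk] <;>
      first | exact h0 | exact hx | exact hz | exact hσx

include hw in
/-- **THE SQUARE-LEVEL-`m` PROFILE IN THE CHART**: `(u(x,z)_w − 1)² ∈ ϖ^m M₃(𝒪_w)` (idiom `∀ i j, |(ϖ^m)⁻¹·(X·X) i j| ≤ 1`) `⟺ |x_w| ≤ |ϖ|^{⌈m∕2⌉}` (the only entry of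
`X²` is `−x_wσx_w`, of valuation `|x_w|²`). [cite: Kottwitz1986BaseChangeUnits, §1 pp. 240–241] [cite: Rogawski1990, §1.10 p. 9] -/
theorem forall_valued_map_heisElt_sub_one_mul_self_le_iff [Invertible (2 : LocalRing L v)] {ϖ : w.1.adicCompletion L} (hϖ : Valued.v ϖ = WithZero.exp (-1 : ℤ)) (m : ℕ)
    (x : LocalRing L v) (y : HeisRing.skewPart (conjLocal L (IsCMField.complexConj L) v)) :
    (∀ i j : Fin 3, Valued.v ((ϖ ^ m)⁻¹ *
        (((((HeisRing.heisElt (conjLocal L (IsCMField.complexConj L) v) (conjLocal_conjLocal_cm L v) (cmLocalForm_eq_over L 3 v) x y :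
          ↥(unitaryGroupOfForm (conjLocal L (IsCMField.complexConj L) v) (cmLocalForm L 3 v))) : GL (Fin 3) (LocalRing L v)).val.map
          (Pi.evalRingHom (fun w' : PlacesOver L v => w'.1.adicCompletion L) w)) - 1) *
         ((((HeisRing.heisElt (conjLocal L (IsCMField.complexConj L) v) (conjLocal_conjLocal_cm L v) (cmLocalForm_eq_over L 3 v) x y :
          ↥(unitaryGroupOfForm (conjLocal L (IsCMField.complexConj L) v) (cmLocalForm L 3 v))) : GL (Fin 3) (LocalRing L v)).val.map
          (Pi.evalRingHom (fun w' : PlacesOver L v => w'.1.adicCompletion L) w)) - 1)) i j) ≤ 1) ↔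
      Valued.v (x w) ≤ WithZero.exp (-(((m + 1) / 2 : ℕ) : ℤ)) := by
  have hσv : ∀ r : LocalRing L v, Valued.v (conjLocal L (IsCMField.complexConj L) v r w) = Valued.v (r w) := valued_conjLocal_apply_of_smul_eq L v w hw
  rw [map_heisElt_sub_one_mul_self_eq L v w x y, ← WithZero.mul_self_le_exp_neg_iff]
  simp only [valued_inv_pow_mul_le_one_iff hϖ]
  have hc : Valued.v (-(x w * (conjLocal L (IsCMField.complexConj L) v x) w)) = Valued.v (x w) * Valued.v (x w) := by
    rw [Valuation.map_neg, map_mul, hσv]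
  constructor
  · intro h
    have h02 := h 0 2
    simp only [Matrix.of_apply, Matrix.cons_val', Matrix.cons_val_zero, Matrix.cons_val_two,
      Matrix.empty_val', Matrix.cons_val_fin_one, Matrix.head_cons, Matrix.tail_cons] at h02
    rwa [hc] at h02
  · intro hx
    have h0 : Valued.v (0 : w.1.adicCompletion L) ≤ WithZero.exp (-(m : ℤ)) := by rw [map_zero]; exact zero_le
    have h02 : Valued.v (-(x w * (conjLocal L (IsCMField.complexConj L) v x) w)) ≤ WithZero.exp (-(m : ℤ)) := by rwa [hc]
    intro i j
    fin_cases i <;> fin_cases j <;>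
      simp only [Matrix.of_apply, Matrix.cons_val', Matrix.cons_val_zero, Matrix.cons_val_one, Matrix.cons_val_two,
        Matrix.empty_val', Matrix.cons_val_fin_one, Matrix.head_cons, Matrix.tail_cons, Fin.zero_eta, Fin.mk_one, Fin.reduceFinMk] <;>
      first | exact h0 | exact h02

/-! ## §3 The trace of `z` and the `x`-fibres of `N ∩ K₃` at a ramified place -/

include hw in
/-- **`z_w + σ_w z_w = −x_w·σ_w x_w`** for `z = heisZ x y`, `y ∈ R⁻` (★ `heisZ_add_map` read at the place `w`; `(σ r)_w = σ_w r_w`, ★ `conjLocal_apply_eq_of_smul_eq`).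
[cite: Rogawski1990, §1.10 p. 9] -/
theorem heisZ_apply_add_map [Invertible (2 : LocalRing L v)] (x : LocalRing L v) (y : HeisRing.skewPart (conjLocal L (IsCMField.complexConj L) v)) :
    (HeisRing.heisZ (conjLocal L (IsCMField.complexConj L) v) x (y : LocalRing L v)) w +
        galAdicCompletionMap (L := L) (IsCMField.complexConj L) hw ((HeisRing.heisZ (conjLocal L (IsCMField.complexConj L) v) x (y : LocalRing L v)) w) =
      -(x w * galAdicCompletionMap (L := L) (IsCMField.complexConj L) hw (x w)) := by
  haveI : Algebra.IsQuadraticExtension ↥(maximalRealSubfield L) L := IsCMField.isQuadraticExtension L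
  have h := HeisRing.heisZ_add_map (conjLocal L (IsCMField.complexConj L) v) (conjLocal_conjLocal_cm L v) x y.2
    (HeisRing.map_invOf_two (conjLocal L (IsCMField.complexConj L) v))
  have hw' := congrFun h w
  rw [Pi.add_apply, Pi.neg_apply, Pi.mul_apply, conjLocal_apply_eq_of_smul_eq (IsCMField.complexConj L) (IsCMField.complexConj_ne_one L) v w hw,
    conjLocal_apply_eq_of_smul_eq (IsCMField.complexConj L) (IsCMField.complexConj_ne_one L) v w hw] at hw'
  exact hw'

include hw in
/-- **NON-EMPTY FIBRE ⟹ `|x_w| ≤ |ϖ|^{⌊(a+d)∕2⌋}`.**  If some skew `y` has `|z_w| ≤ |ϖ|^a` (`z = heisZ x y`), then `x_wσx_w = −Tr z_w ∈ Tr 𝔓_w^a ⊆ 𝔭_v^{⌊(a+d)∕2⌋}`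
(★ `WildQuadraticDatum.v_add_map_le_exp`), so `|x_w|² ≤ |ϖ|^{2⌊(a+d)∕2⌋}`. [cite: Serre1979, Ch. III §3 Prop. 7] [cite: Rogawski1990, §1.10 p. 9] -/
theorem v_apply_le_of_valued_heisZ_le [Invertible (2 : LocalRing L v)] {ϖ : w.1.adicCompletion L} {d t : ℕ}
    (hD : UnitaryThreeFourFrame.IsRamifiedQuadraticDatum (galAdicCompletionMap (L := L) (IsCMField.complexConj L) hw) ϖ d t) (a : ℕ)
    (x : LocalRing L v) (y : HeisRing.skewPart (conjLocal L (IsCMField.complexConj L) v))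
    (hz : Valued.v ((HeisRing.heisZ (conjLocal L (IsCMField.complexConj L) v) x (y : LocalRing L v)) w) ≤ WithZero.exp (-(a : ℤ))) :
    Valued.v (x w) ≤ WithZero.exp (-(((a + d) / 2 : ℕ) : ℤ)) := by
  obtain ⟨hσσ, hvσ, hϖ, hfix, hd, -, ht⟩ := hD
  have htr := WildQuadraticDatum.v_add_map_le_exp hσσ hfix hϖ hd ht (j := a) (m := ((a + d) / 2 : ℕ)) hz (by omega)
  rw [heisZ_apply_add_map L v w hw x y, Valuation.map_neg, map_mul, hvσ] at htr
  have h2 : ((2 * ((a + d) / 2 : ℕ) : ℕ) : ℤ) = 2 * (((a + d) / 2 : ℕ) : ℤ) := by push_cast; ring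
  have hsq : Valued.v (x w) * Valued.v (x w) ≤ WithZero.exp (-((2 * ((a + d) / 2 : ℕ) : ℕ) : ℤ)) := by rwa [h2]
  rw [WithZero.mul_self_le_exp_neg_iff] at hsq
  have h3 : (2 * ((a + d) / 2) + 1) / 2 = (a + d) / 2 := by omega
  rwa [h3] at hsq

include hw in
/-- **`|x_w| ≤ |ϖ|^{⌊(a+d)∕2⌋}` ⟹ THE FIBRE IS NON-EMPTY**: there is a skew `y₀ ∈ R⁻` with `|z_w| ≤ |ϖ|^a`, `z = heisZ x y₀` — take `c ∈ 𝔓_w^a` with `c + σc = −x_wσx_w`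
(★ `WildQuadraticDatum.exists_v_le_add_map_eq`) and `y₀ := c + ½ xσx` (skew precisely because of the trace identity). [cite: Serre1979, Ch. III §3 Prop. 7]
[cite: Rogawski1990, §1.10 p. 9] -/
theorem exists_skew_valued_heisZ_le [Invertible (2 : LocalRing L v)] {ϖ : w.1.adicCompletion L} {d t : ℕ}
    (hD : UnitaryThreeFourFrame.IsRamifiedQuadraticDatum (galAdicCompletionMap (L := L) (IsCMField.complexConj L) hw) ϖ d t) (a : ℕ)
    (x : LocalRing L v) (hx : Valued.v (x w) ≤ WithZero.exp (-(((a + d) / 2 : ℕ) : ℤ))) :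
    ∃ y₀ : HeisRing.skewPart (conjLocal L (IsCMField.complexConj L) v),
      Valued.v ((HeisRing.heisZ (conjLocal L (IsCMField.complexConj L) v) x (y₀ : LocalRing L v)) w) ≤ WithZero.exp (-(a : ℤ)) := by
  haveI : Algebra.IsQuadraticExtension ↥(maximalRealSubfield L) L := IsCMField.isQuadraticExtension L
  haveI : Subsingleton (PlacesOver L v) :=
    PlacesOver.subsingleton_of_smul_eq (IsCMField.complexConj L) (IsCMField.complexConj_ne_one L) w hw
  obtain ⟨hσσ, hvσ, hϖ, hfix, hd, -, ht⟩ := hD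
  have hσw : ∀ r : LocalRing L v, conjLocal L (IsCMField.complexConj L) v r w = galAdicCompletionMap (L := L) (IsCMField.complexConj L) hw (r w) :=
    fun r => conjLocal_apply_eq_of_smul_eq (IsCMField.complexConj L) (IsCMField.complexConj_ne_one L) v w hw r
  -- the target trace `−x_w σx_w` is `σ_w`-fixed of valuation `|x_w|² ≤ exp(−2⌊(a+d)∕2⌋)`
  have hfixed : galAdicCompletionMap (L := L) (IsCMField.complexConj L) hw (-(x w * galAdicCompletionMap (L := L) (IsCMField.complexConj L) hw (x w))) =
      -(x w * galAdicCompletionMap (L := L) (IsCMField.complexConj L) hw (x w)) := by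
    rw [map_neg, map_mul, hσσ, mul_comm]
  have hvy : Valued.v (-(x w * galAdicCompletionMap (L := L) (IsCMField.complexConj L) hw (x w))) ≤ WithZero.exp (-(2 * (((a + d) / 2 : ℕ) : ℤ))) := by
    rw [Valuation.map_neg, map_mul, hvσ, show (-(2 * (((a + d) / 2 : ℕ) : ℤ))) = -(((a + d) / 2 : ℕ) : ℤ) + -(((a + d) / 2 : ℕ) : ℤ) by ring, WithZero.exp_add]
    exact mul_le_mul' hx hx
  obtain ⟨c, hc, hcc⟩ := WildQuadraticDatum.exists_v_le_add_map_eq hσσ hfix hϖ hd ht hfixed (j := a) hvy (by omega)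
  -- lift `c` to `R` (evaluation at the only place `w` is surjective) and set `y₀ := c + ½ x σx`
  obtain ⟨r, hr'⟩ := Function.surjective_eval (β := fun w' : PlacesOver L v => w'.1.adicCompletion L) w c
  have hr : r w = c := hr'
  have h2 : conjLocal L (IsCMField.complexConj L) v (⅟(2 : LocalRing L v)) = ⅟(2 : LocalRing L v) := HeisRing.map_invOf_two _
  have hhalf : (⅟(2 : LocalRing L v)) w + (⅟(2 : LocalRing L v)) w = 1 := by
    have h := congrFun (invOf_mul_self (2 : LocalRing L v)) w
    rw [Pi.mul_apply, Pi.one_apply, Pi.ofNat_apply] at h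
    linear_combination h
  have hskew : r + ⅟(2 : LocalRing L v) * (x * conjLocal L (IsCMField.complexConj L) v x) ∈ HeisRing.skewPart (conjLocal L (IsCMField.complexConj L) v) := by
    rw [HeisRing.mem_skewPart_iff]
    funext w'
    obtain rfl : w' = w := Subsingleton.elim _ _
    have e1 : (conjLocal L (IsCMField.complexConj L) v (r + ⅟(2 : LocalRing L v) * (x * conjLocal L (IsCMField.complexConj L) v x))) w' =
        galAdicCompletionMap (L := L) (IsCMField.complexConj L) hw c +
          (⅟(2 : LocalRing L v)) w' * (galAdicCompletionMap (L := L) (IsCMField.complexConj L) hw (x w') * x w') := by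
      rw [map_add, map_mul, h2, map_mul, conjLocal_conjLocal_cm, Pi.add_apply, Pi.mul_apply, Pi.mul_apply, hσw r, hσw x, hr]
    have e2 : (-(r + ⅟(2 : LocalRing L v) * (x * conjLocal L (IsCMField.complexConj L) v x))) w' =
        -(c + (⅟(2 : LocalRing L v)) w' * (x w' * galAdicCompletionMap (L := L) (IsCMField.complexConj L) hw (x w'))) := by
      rw [Pi.neg_apply, Pi.add_apply, Pi.mul_apply, Pi.mul_apply, hσw x, hr]
    rw [e1, e2]
    linear_combination hcc + (x w' * galAdicCompletionMap (L := L) (IsCMField.complexConj L) hw (x w')) * hhalf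
  refine ⟨⟨r + ⅟(2 : LocalRing L v) * (x * conjLocal L (IsCMField.complexConj L) v x), hskew⟩, ?_⟩
  have hz : (HeisRing.heisZ (conjLocal L (IsCMField.complexConj L) v) x
      (r + ⅟(2 : LocalRing L v) * (x * conjLocal L (IsCMField.complexConj L) v x))) w = c := by
    rw [HeisRing.heisZ, Pi.sub_apply, Pi.add_apply, Pi.mul_apply, Pi.mul_apply, hr]
    ring
  change Valued.v ((HeisRing.heisZ (conjLocal L (IsCMField.complexConj L) v) x
      (r + ⅟(2 : LocalRing L v) * (x * conjLocal L (IsCMField.complexConj L) v x))) w) ≤ _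
  rw [hz]
  exact hc

/-- **THE FIBRE IS A COSET OF THE SKEW BALL**: if `y₀ ∈ R⁻` has `|(heisZ x y₀)_w| ≤ |ϖ|^a` then `{y ∈ R⁻ : |(heisZ x y)_w| ≤ |ϖ|^a} = y₀ + {y ∈ R⁻ : |y_w| ≤ |ϖ|^a}`
(`heisZ x y − heisZ x y₀ = y − y₀` and the ultrametric inequality). [cite: Rogawski1990, §1.10 p. 9] [cite: Serre1979, Ch. III §3 Prop. 7] -/
theorem setOf_valued_heisZ_le_eq_vadd [Invertible (2 : LocalRing L v)] (γ : ℤᵐ⁰) (x : LocalRing L v)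
    (y₀ : HeisRing.skewPart (conjLocal L (IsCMField.complexConj L) v))
    (hy₀ : Valued.v ((HeisRing.heisZ (conjLocal L (IsCMField.complexConj L) v) x (y₀ : LocalRing L v)) w) ≤ γ) :
    {y : HeisRing.skewPart (conjLocal L (IsCMField.complexConj L) v) |
        Valued.v ((HeisRing.heisZ (conjLocal L (IsCMField.complexConj L) v) x (y : LocalRing L v)) w) ≤ γ} =
      y₀ +ᵥ {y : HeisRing.skewPart (conjLocal L (IsCMField.complexConj L) v) | Valued.v ((y : LocalRing L v) w) ≤ γ} := by
  have hdiff : ∀ y : HeisRing.skewPart (conjLocal L (IsCMField.complexConj L) v),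
      (HeisRing.heisZ (conjLocal L (IsCMField.complexConj L) v) x (y : LocalRing L v)) w =
        (HeisRing.heisZ (conjLocal L (IsCMField.complexConj L) v) x (y₀ : LocalRing L v)) w + (((-y₀ + y : HeisRing.skewPart (conjLocal L (IsCMField.complexConj L) v)) : LocalRing L v) w) := by
    intro y
    simp only [HeisRing.heisZ, AddSubgroup.coe_add, AddSubgroup.coe_neg, Pi.sub_apply, Pi.add_apply, Pi.neg_apply]
    ring
  ext y
  rw [Set.mem_setOf_eq, Set.mem_vadd_set_iff_neg_vadd_mem, vadd_eq_add, Set.mem_setOf_eq, hdiff y]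
  constructor
  · intro h
    have h' := Valuation.map_add Valued.v (-((HeisRing.heisZ (conjLocal L (IsCMField.complexConj L) v) x (y₀ : LocalRing L v)) w))
      ((HeisRing.heisZ (conjLocal L (IsCMField.complexConj L) v) x (y₀ : LocalRing L v)) w + (((-y₀ + y : HeisRing.skewPart (conjLocal L (IsCMField.complexConj L) v)) : LocalRing L v) w))
    rw [neg_add_cancel_left, Valuation.map_neg] at h'
    exact h'.trans (max_le hy₀ h)
  · intro h
    exact (Valuation.map_add Valued.v _ _).trans (max_le hy₀ h)

/-! ## §4 Skew parity on `R⁻` at a ramified place -/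

include hw in
/-- **SKEW PARITY on `R⁻`**: a skew `y ∈ R⁻` with `y_w ≠ 0` has `|y_w| = exp(2n − d)` for some `n ∈ ℤ` (★ `WildQuadraticDatum.exists_v_eq_exp_of_map_eq_neg` at `σ_w`).
[cite: Serre1979, Ch. III §6 Prop. 13] -/
theorem exists_valued_skew_apply_eq_exp {ϖ : w.1.adicCompletion L} {d t : ℕ}
    (hD : UnitaryThreeFourFrame.IsRamifiedQuadraticDatum (galAdicCompletionMap (L := L) (IsCMField.complexConj L) hw) ϖ d t)
    (y : HeisRing.skewPart (conjLocal L (IsCMField.complexConj L) v)) (hy : (y : LocalRing L v) w ≠ 0) :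
    ∃ n : ℤ, Valued.v ((y : LocalRing L v) w) = WithZero.exp (2 * n - d) := by
  haveI : Algebra.IsQuadraticExtension ↥(maximalRealSubfield L) L := IsCMField.isQuadraticExtension L
  obtain ⟨hσσ, -, hϖ, hfix, hd, -, -⟩ := hD
  have hskew : galAdicCompletionMap (L := L) (IsCMField.complexConj L) hw ((y : LocalRing L v) w) = -((y : LocalRing L v) w) := by
    rw [← conjLocal_apply_eq_of_smul_eq (IsCMField.complexConj L) (IsCMField.complexConj_ne_one L) v w hw, (HeisRing.mem_skewPart_iff _ _).1 y.2, Pi.neg_apply]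
  exact WildQuadraticDatum.exists_v_eq_exp_of_map_eq_neg hσσ hfix hϖ hd hskew hy

include hw in
/-- **`B_k = B_{k+1}` on the skew line when `k + d` is odd**: no skew element has `|y_w| = exp(−k)` unless `k ≡ d (mod 2)`, so the skew balls
`B_k = {y ∈ R⁻ : |y_w| ≤ exp(−k)}` only jump at exponents of the parity of `d`. [cite: Serre1979, Ch. III §6 Prop. 13] -/
theorem setOf_skew_valued_le_exp_eq_succ_of_odd {ϖ : w.1.adicCompletion L} {d t : ℕ}
    (hD : UnitaryThreeFourFrame.IsRamifiedQuadraticDatum (galAdicCompletionMap (L := L) (IsCMField.complexConj L) hw) ϖ d t) (k : ℤ) (hk : Odd (k + d)) :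
    {y : HeisRing.skewPart (conjLocal L (IsCMField.complexConj L) v) | Valued.v ((y : LocalRing L v) w) ≤ WithZero.exp (-k)} =
      {y : HeisRing.skewPart (conjLocal L (IsCMField.complexConj L) v) | Valued.v ((y : LocalRing L v) w) ≤ WithZero.exp (-(k + 1))} := by
  ext y
  simp only [Set.mem_setOf_eq]
  constructor
  · intro h
    by_cases hy : (y : LocalRing L v) w = 0
    · rw [hy, map_zero]; exact zero_le
    · obtain ⟨n, hn⟩ := exists_valued_skew_apply_eq_exp L v w hw hD y hy
      rw [hn, WithZero.exp_le_exp] at h ⊢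
      obtain ⟨r, hr⟩ := hk
      omega
  · intro h
    exact h.trans (WithZero.exp_le_exp.2 (by omega))

end Literature.NumberTheory.Automorphic.UnitaryGroup

end
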